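import Mathlib
import Literature.Probability.LatticeModels.ConformalCovariance
import Literature.Probability.LatticeModels.ScalingLimit
import Literature.Probability.LatticeModels.IsingThermodynamics
import Summits.CriticalPhenomena.Ising3DConformalLimit.Theses.GaussianScaleMixture

/-!
# Sketch (crux-ideate, stmt-CriticalPhenomena-8367, ideator 3, generation 2, round 1)

First lemmas for the crux idea card `complex-quarter-turn-liouville`
("run Bargmann–Hall–Wightman backwards on one complexified lattice-axis rotation orbit").

Nothing here is an item.  Statements are `def … : Prop`; two small sanity proofs.
* `crux_iff`                         — the crux is `CruxHyp → IsRotationInvariant` (proved, read-back).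
* `rot3`, `rot1`, `orbit3`, `orbit1` — rotations about the lattice axes `e₃`, `e₁` and the orbit functions.
* `PeriodicEntireSubfrequencyConst`  — (L1) Liouville with the `B₃` frequency gap: entire, `π/2`-periodic,
                                       growth `O(e^{(4-ε)|Im θ|})` ⇒ constant.            [pure, provable now]
* `PeriodicEntireTwoRayNonnegConst`  — (L1′) parity upgrade: + real on `ℝ`, `≥ 0` on `iℝ` (coordinate picture)
                                       and on `π/4 + iℝ` (diagonal picture) ⇒ budget `O(e^{(8-ε)|Im θ|})`. [pure]
* `AxisOrbitsGenerate`               — (L2) Euler: orbit-constancy about `e₃` and `e₁` (+ the free `-1`) ⇒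
                                       `IsRotationInvariant`.                               [pure, provable now]
* `QuarterTurnPeriodic`              — (P) `π/2`-periodicity of the real orbit functions of any limit
                                       (= `cubicInvariant_free` of Disproof.lean, restated on orbits).
* `QuarterTurnGrowth`                — (C⁺) THE TRANSFER: the quarter-turn orbits of the pinned limit are entire
                                       of growth `< e^{4|Im θ|}` (sub-frequency growth).
* `SharpTubeE2`                      — (T2, Euclidean/Paley–Wiener form) the sharp lattice-frame spectrum
                                       condition `H₂ ≥ |P₁|` written on Schwinger functions (support input of C⁺).
* `crux_of_quarterTurn_shape`        — the composition C⁺ ∧ P ∧ L1 ∧ L2 ⇒ crux, as a `Prop` (proof = crux-plan).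
-/

namespace Summit.CriticalPhenomena.Ising3DConformalLimit.Cruxes.RotationUpgradeFromTwoPoint.Ideator3G2

open Literature.Probability.LatticeModels

/-- `ℝ³`. -/
abbrev E3 := EuclideanSpace ℝ (Fin 3)

/-- The hypotheses (H1)–(H7) of the crux `RotationUpgradeFromTwoPoint`, bundled. -/
def CruxHyp (ρ : ℝ → ℝ) (Δ : ℝ) (S : CorrFamily 3) : Prop :=
  (∀ δ ∈ Set.Ioc (0:ℝ) 1, 0 < ρ δ) ∧
  HasPointwiseScalingLimit (criticalCorr 3) ρ S ∧
  (∀ n z, z ∉ NonCoincident 3 n → S n z = 0) ∧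
  IsNondegenerateTwoPoint S ∧ IsTranslationInvariant S ∧ IsScaleCovariant Δ S ∧
  (∀ (R : E3 ≃ₗᵢ[ℝ] E3) (x : E3), x ≠ 0 → S 2 ![0, R x] = S 2 ![0, x])

/-- Read-back: the crux is exactly `CruxHyp → IsRotationInvariant`. -/
theorem crux_iff :
    Theses.GaussianScaleMixture.RotationUpgradeFromTwoPoint ↔
      ∀ ρ Δ S, CruxHyp ρ Δ S → IsRotationInvariant S := by
  unfold Theses.GaussianScaleMixture.RotationUpgradeFromTwoPoint CruxHyp
  constructor
  · intro h ρ Δ S hh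
    exact h ρ Δ S hh.1 hh.2.1 hh.2.2.1 hh.2.2.2.1 hh.2.2.2.2.1 hh.2.2.2.2.2.1 hh.2.2.2.2.2.2
  · intro h ρ Δ S h1 h2 h3 h4 h5 h6 h7
    exact h ρ Δ S ⟨h1, h2, h3, h4, h5, h6, h7⟩

/-! ## Lattice-axis rotations and orbit functions -/

/-- Rotation by the real angle `θ` about the lattice axis `e₃` (fixes the third coordinate). -/
noncomputable def rot3 (θ : ℝ) (p : E3) : E3 :=
  WithLp.toLp 2 ![Real.cos θ * p 0 - Real.sin θ * p 1, Real.sin θ * p 0 + Real.cos θ * p 1, p 2]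

/-- Rotation by the real angle `θ` about the lattice axis `e₁` (fixes the first coordinate). -/
noncomputable def rot1 (θ : ℝ) (p : E3) : E3 :=
  WithLp.toLp 2 ![p 0, Real.cos θ * p 1 - Real.sin θ * p 2, Real.sin θ * p 1 + Real.cos θ * p 2]

/-- The real quarter-turn orbit function of order `n` through the configuration `z`, axis `e₃`:
`θ ↦ S_n(R^{e₃}_θ z₁, …, R^{e₃}_θ zₙ)`. -/
noncomputable def orbit3 (S : CorrFamily 3) (n : ℕ) (z : Fin n → E3) (θ : ℝ) : ℝ :=
  S n (fun i => rot3 θ (z i))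

/-- The same about the axis `e₁`. -/
noncomputable def orbit1 (S : CorrFamily 3) (n : ℕ) (z : Fin n → E3) (θ : ℝ) : ℝ :=
  S n (fun i => rot1 θ (z i))

/-! ## (L1) Liouville with the `B₃` frequency gap -/

/-- **(L1)** An entire, `π/2`-periodic function of growth `O(e^{(4-ε)|Im θ|})` is constant.
(Fourier modes of a `π/2`-periodic entire function are `e^{4imθ}`; the coefficient `c_m` is read off on the
line `Im θ = τ` with weight `e^{4mτ}`; the growth bound kills every `m ≠ 0`.)  Pure complex analysis. -/
def PeriodicEntireSubfrequencyConst : Prop :=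
  ∀ (g : ℂ → ℂ) (C ε : ℝ), 0 < ε → Differentiable ℂ g →
    (∀ w : ℂ, g (w + (Real.pi / 2 : ℝ)) = g w) →
    (∀ w : ℂ, ‖g w‖ ≤ C * Real.exp ((4 - ε) * |w.im|)) →
    ∀ w w' : ℂ, g w = g w'

/-- **(L1′) parity upgrade.** If moreover `g` is real on `ℝ` and NON-NEGATIVE on the two rays `iℝ`
(coordinate-mirror picture: `g(iτ) = ‖Ψ(τ)‖²`) and `π/4 + iℝ` (diagonal-mirror picture), then the Laurent
polynomial `G(q) = Σ c_m q^m`, `q = e^{4iθ}`, has real coefficients with `c_{-m} = c_m` and is `≥ 0` on both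
real half-axes, so its top index is EVEN with positive coefficient: the first harmonic that could survive is
`m = 2` (frequency 8) and the growth budget doubles to `O(e^{(8-ε)|Im θ|})`. -/
def PeriodicEntireTwoRayNonnegConst : Prop :=
  ∀ (g : ℂ → ℂ) (C ε : ℝ), 0 < ε → Differentiable ℂ g →
    (∀ w : ℂ, g (w + (Real.pi / 2 : ℝ)) = g w) →
    (∀ t : ℝ, (g t).im = 0) →
    (∀ τ : ℝ, 0 ≤ (g (τ * Complex.I)).re ∧ (g (τ * Complex.I)).im = 0) →
    (∀ τ : ℝ, 0 ≤ (g ((Real.pi / 4 : ℝ) + τ * Complex.I)).re ∧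
        (g ((Real.pi / 4 : ℝ) + τ * Complex.I)).im = 0) →
    (∀ w : ℂ, ‖g w‖ ≤ C * Real.exp ((8 - ε) * |w.im|)) →
    ∀ w w' : ℂ, g w = g w'

/-! ## (L2) Two lattice axes generate all rotations -/

/-- **(L2)** Euler angles: every element of `SO(3)` is `R^{e₃}_α R^{e₁}_β R^{e₃}_γ`, and `O(3) = SO(3) × {±1}`;
so constancy of all orbit functions about `e₃` and `e₁`, together with the FREE point reflection
(`limit_neg` in the tree, `neg_free` in Disproof.lean), is `IsRotationInvariant`.  Pure group theory. -/
def AxisOrbitsGenerate : Prop :=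
  ∀ (S : CorrFamily 3),
    (∀ n (z : Fin n → E3) (θ : ℝ), orbit3 S n z θ = S n z) →
    (∀ n (z : Fin n → E3) (θ : ℝ), orbit1 S n z θ = S n z) →
    (∀ n (z : Fin n → E3), S n (fun i => - z i) = S n z) →
    IsRotationInvariant S

/-! ## (P) periodicity and (C⁺) the transfer -/

/-- **(P)** `π/2`-PERIODICITY of the real orbit functions of the pinned limit: `R^{e_j}_{π/2}` is a signed
coordinate permutation, and `B₃` acts trivially on every pointwise limit of `criticalCorr 3` normalised off
`NonCoincident` (tree `limit_coordPerm` / `limit_signFlip`; Disproof `cubicInvariant_free`). -/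
def QuarterTurnPeriodic : Prop :=
  ∀ (ρ : ℝ → ℝ) (Δ : ℝ) (S : CorrFamily 3), CruxHyp ρ Δ S →
    ∀ n (z : Fin n → E3) (θ : ℝ),
      orbit3 S n z (θ + Real.pi / 2) = orbit3 S n z θ ∧ orbit1 S n z (θ + Real.pi / 2) = orbit1 S n z θ

/-- **(C⁺) QuarterTurnGrowth — the transfer.**  For the pinned limit `S` of the crux, every quarter-turn orbit
function about a lattice axis through a non-coincident configuration is the restriction to `ℝ` of an ENTIRE
function of SUB-FREQUENCY GROWTH `O(e^{(4-ε)|Im θ|})`.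
Intended proof (card): entire ⇐ nine-mirror OS positivity with the SHARP lattice-frame tube (`SharpTubeE2`):
the complex orbit `R_{a+iτ} z` has real `e₂`-gaps `cosh τ·d₂` against imaginary `e₁`-gaps `sinh τ·d₂`, inside
the slope-1 tube for all `τ` with margin `e^{-|τ|}d₂`; growth ⇐ boosted OS vectors (`K± = H₂ ± P₁`,
`K₋ ↦ e^{τ}K₋`, `K₊ ↦ e^{-τ}K₊`), contraction domination, dilation by `e^{2τ}`, one-particle boost invariance
(round `S₂`) and the energy bound for `σ`: crude rate `s^{-4Δ}` against the kill threshold `s^{-2Δ-2}`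
(`s = e^{-2τ}`), i.e. excess `2Δ ≤ 2` — closed for `Δ < 1` as stated, for all `Δ ∈ [1/2,1]` with the parity
budget `8` of (L1′). -/
def QuarterTurnGrowth : Prop :=
  ∀ (ρ : ℝ → ℝ) (Δ : ℝ) (S : CorrFamily 3), CruxHyp ρ Δ S →
    ∀ n (z : Fin n → E3), z ∈ NonCoincident 3 n →
      (∃ (G : ℂ → ℂ) (C ε : ℝ), 0 < ε ∧ Differentiable ℂ G ∧
          (∀ θ : ℝ, G θ = orbit3 S n z θ) ∧
          ∀ w : ℂ, ‖G w‖ ≤ C * Real.exp ((4 - ε) * |w.im|)) ∧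
      (∃ (G : ℂ → ℂ) (C ε : ℝ), 0 < ε ∧ Differentiable ℂ G ∧
          (∀ θ : ℝ, G θ = orbit1 S n z θ) ∧
          ∀ w : ℂ, ‖G w‖ ≤ C * Real.exp ((4 - ε) * |w.im|))

/-! ## (T2) the sharp lattice-frame tube, Euclidean form -/

/-- The coordinate mirror `x₂ ↦ -x₂`. -/
noncomputable def mirror2 (p : E3) : E3 := WithLp.toLp 2 ![p 0, -(p 1), p 2]

/-- **(T2) SharpTubeE2** (Paley–Wiener / Euclidean form of the SHARP lattice-frame spectrum condition
`H₂ ≥ |P₁|` in the `e₂`-picture OS space): for a finite cloud `z` strictly above the mirror `x₂ = 0`, the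
mirror-doubled `2n`-point function of the upper copy translated by the REAL transverse shift `b·e₁`,
`b ↦ S_{2n}(θ₂ z, z + b e₁) = ⟨Ψ_z, e^{ibP₁}Ψ_z⟩`, extends to a function holomorphic in the strip
`|Im b| < 2·min_i (z_i)₂` (imaginary transverse translation costs `e^{|Im b|·|P₁|} ≤ e^{|Im b| H₂}`).  Slope
exactly `1` is what the 45° diagonal mirrors `(e₂ ± e₁)/√2` encode; ANY slope `v < 1` is useless for C⁺ (the
complex orbit exits a slope-`v` tube at `tanh τ = v`).  Gram-matrix version over finitely many clouds likewise;
`e₃`-shifts and the other pictures by `B₃`. -/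
def SharpTubeE2 (S : CorrFamily 3) : Prop :=
  ∀ n (z : Fin n → E3) (h : ℝ), 0 < h → (∀ i, h ≤ z i 1) → z ∈ NonCoincident 3 n →
    ∃ F : ℂ → ℂ, DifferentiableOn ℂ F {b : ℂ | |b.im| < 2 * h} ∧
      ∀ b : ℝ, F b = S (n + n)
        (Fin.append (fun i => mirror2 (z i)) (fun i => z i + b • EuclideanSpace.single (0 : Fin 3) (1 : ℝ)))

/-- The sharp tube for the pinned limit (support input of C⁺; shared fate with route ModularBoosts' item (L),
whose "some `v > 0`" this pins to `v = 1`). -/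
def LimitSharpTube : Prop :=
  ∀ (ρ : ℝ → ℝ) (Δ : ℝ) (S : CorrFamily 3), CruxHyp ρ Δ S → SharpTubeE2 S

/-! ## Composition shape -/

/-- The free point reflection, as used by (L2): `S_n(-z) = S_n(z)` for every pinned limit
(tree `limit_neg`, Disproof `neg_free`). -/
def LimitNegFree : Prop :=
  ∀ (ρ : ℝ → ℝ) (Δ : ℝ) (S : CorrFamily 3), CruxHyp ρ Δ S →
    ∀ n (z : Fin n → E3), S n (fun i => - z i) = S n z

/-- **Composition (to be kernel-checked at crux-plan):** C⁺ ∧ (P) ∧ (L1) ∧ (L2) ∧ (free `-1`) ⇒ crux.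
Proof route: from C⁺ take the entire `G` agreeing with the orbit on `ℝ`; (P) on `ℝ` + the identity theorem give
`G(w + π/2) = G w` on `ℂ`; (L1) gives `G` constant, so every orbit function about `e₃`/`e₁` through a
non-coincident configuration is constant; off `NonCoincident` both sides vanish (normalisation, orbits of
non-coincident configurations stay non-coincident); (L2) with the free `-1` gives `IsRotationInvariant`. -/
def CruxOfQuarterTurnShape : Prop :=
  QuarterTurnGrowth → QuarterTurnPeriodic → PeriodicEntireSubfrequencyConst → AxisOrbitsGenerate →
    LimitNegFree → Theses.GaussianScaleMixture.RotationUpgradeFromTwoPoint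

/-- Sanity (definitional): the composition shape concludes the crux BY NAME. -/
example (h : CruxOfQuarterTurnShape) (h1 : QuarterTurnGrowth) (h2 : QuarterTurnPeriodic)
    (h3 : PeriodicEntireSubfrequencyConst) (h4 : AxisOrbitsGenerate) (h5 : LimitNegFree) :
    Theses.GaussianScaleMixture.RotationUpgradeFromTwoPoint :=
  h h1 h2 h3 h4 h5

/-- Sanity: `rot3 0` is the identity (so orbit functions pass through `S n z` at `θ = 0`). -/
theorem rot3_zero (p : E3) : rot3 0 p = p := by
  ext i
  fin_cases i <;> simp [rot3]

end Summit.CriticalPhenomena.Ising3DConformalLimit.Cruxes.RotationUpgradeFromTwoPoint.Ideator3G2
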